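import Mathlib
import HarnessLib
import Summits.NavierStokesRegularity.NavierStokesRegularity.Theses.LocalIrrotationalScarDoor

/-!
# Route `LocalIrrotationalScarDoor` (door S15, nsreg-p1 ROUND-14) — birth closer for the item `AssemblyRep`

Filed by nsreg-p6 (the door is MOOT-BY-PROOF: K1Rep p493989, K2Rep p489778, Target p494432 are tree theorems).
WHAT THIS IS NOT: not NS regularity — a by-name link from the route item to a tree theorem.
-/

noncomputable section

-- the summit and its single sub-problem share the name (CONVENTIONS §1), as in every Theorems file
set_option linter.dupNamespace false

namespace Summit.NavierStokesRegularity.NavierStokesRegularity.Theorems.LocalIrrotationalScarDoorAssemblyRep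

/-- **AssemblyRep holds** (birth closer; pure logic = the route's `closes`): `K1Rep → K2Rep → Target`. -/
theorem assemblyRep_proof : Summit.NavierStokesRegularity.NavierStokesRegularity.Theses.LocalIrrotationalScarDoor.AssemblyRep := by
  intro h₁ h₂ ν T hν hT u p hcl hLH hdec x₀ e ρ M he hρ hI htr hC1 hcurl
  by_contra hbb
  have hopen : IsOpen {y : EuclideanSpace ℝ (Fin 3) | 0 < inner ℝ y e} :=
    isOpen_lt continuous_const (continuous_id.inner continuous_const)
  have hdil : ∀ y ∈ {y : EuclideanSpace ℝ (Fin 3) | 0 < inner ℝ y e}, ∀ c : ℝ, 0 < c →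
      c • y ∈ {y : EuclideanSpace ℝ (Fin 3) | 0 < inner ℝ y e} := by
    intro y hy c hc
    simp only [Set.mem_setOf_eq] at hy ⊢
    rw [real_inner_smul_left]
    exact mul_pos hc hy
  have h0 : (0 : EuclideanSpace ℝ (Fin 3)) ∉ {y : EuclideanSpace ℝ (Fin 3) | 0 < inner ℝ y e} := by
    simp [inner_zero_left]
  obtain ⟨C, w, π, H, Uc, hsw, hwg, hIw, hapex, hsing, hUc, hUcc, htopc⟩ :=
    h₁ ν T hν hT u p hcl hLH hdec x₀ {y : EuclideanSpace ℝ (Fin 3) | 0 < inner ℝ y e} ρ M hopen hdil h0 hρ hI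
      htr hC1 hcurl hbb
  exact h₂ C e he w π H Uc hsw hwg hIw hapex hUc hUcc (fun x₁ hx₁ => htopc x₁ hx₁) hsing

end Summit.NavierStokesRegularity.NavierStokesRegularity.Theorems.LocalIrrotationalScarDoorAssemblyRep

end
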